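import Summits.BirchSwinnertonDyer.BirchSwinnertonDyer.Theorems.AdditiveBranchIMCGordTwoRankZeroOffCaseOneFieldSupplyR0Aux
import Literature.NumberTheory.EllipticCurves.QuadraticTwistLFunctionProofs
import HarnessLib

/-!
# The twisted Wan road (crux 19357, line `three_field_road`, design D2 of FieldTwoTwisted): THE RECIPROCITY IDENTITY
# behind the sign of the auxiliary twist (LeadReport23 §9)

Theorems only (LEAD g15), pure arithmetic. In design D2 the master root-number engine (p798928) gives
`w(V^{(D′)}) = χ₄(|D′|) · (∏_{r ∥ N_V, r ≠ q} (D′/r)) · w(V)` while the partner relation gives `w(E) = (−1/p)(N_V/p) w(V)`;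
with the prescriptions `(D′/r) = (p*/r)` at the odd `r ∥ N_V`, the two are tied together by

  `∏_{r ∈ N.primeFactors ∖ {q}} [f_r = 1] (D′/r) = (N/p)`,

valid when every exponent of `N` is `1` or `2`, `f_q ≠ 1`, `p ∤ N` odd, and `(2/p) = 1` if `2 ∥ N` — quadratic reciprocity in the form
`(p*/r) = (r/p)` (`WeierstrassCurve.legendreSym_pStar`) and `(N/p) = ∏_r (r/p)^{f_r}`.

* `jacobiSym_natCast_eq_prod_primeFactors` — `(N/p) = ∏_{r ∣ N} [f_r = 1] (r/p)` when all `f_r ∈ {1, 2}` and `p ∤ N`;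
* `jacobiSym_pStar_eq_swap` — `(p*/r) = (r/p)` for distinct odd primes, in Jacobi-symbol currency;
* `prod_engine_eq_jacobiSym` — the displayed identity.

References: [IrelandRosen1990] Ch. 5 §2 (quadratic reciprocity and the Jacobi symbol).
-/

set_option linter.dupNamespace false
set_option autoImplicit false

open scoped Classical

namespace Summit.BirchSwinnertonDyer.BirchSwinnertonDyer.Theorems.TwistedWanRoad

open NumberTheorySymbols

/-- `(N / p) = ∏_{r ∣ N, f_r = 1} (r / p)` for `p ∤ N` prime when every exponent of `N` is `1` or `2`
(`N = ∏ r^{f_r}`, multiplicativity of the Jacobi symbol in the numerator, `(r/p)² = 1`). [cite: IrelandRosen1990, Ch. 5 §2 Prop. 5.2.2] -/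
theorem jacobiSym_natCast_eq_prod_primeFactors {N p : ℕ} (hp : p.Prime) (hN0 : N ≠ 0) (hpN : ¬ p ∣ N)
    (hf : ∀ r ∈ N.primeFactors, N.factorization r = 1 ∨ N.factorization r = 2) :
    J((N : ℤ) | p) = ∏ r ∈ N.primeFactors, (if N.factorization r = 1 then J((r : ℤ) | p) else 1) := by
  have hprod : (N : ℤ) = ∏ r ∈ N.primeFactors, ((r : ℤ) ^ (N.factorization r)) := by
    conv_lhs => rw [← Nat.prod_factorization_pow_eq_self hN0]
    rw [Finsupp.prod, Nat.support_factorization]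
    push_cast
    rfl
  let φ : ℤ →* ℤ :=
    { toFun := fun a ↦ J(a | p), map_one' := jacobiSym.one_left p, map_mul' := fun a b ↦ jacobiSym.mul_left a b p }
  have hφ : ∀ a, J(a | p) = φ a := fun _ ↦ rfl
  rw [hprod, hφ, map_prod]
  refine Finset.prod_congr rfl (fun r hr ↦ ?_)
  have hr' := Nat.mem_primeFactors.mp hr
  have hrp : ¬ (p : ℤ) ∣ (r : ℤ) := by
    intro h
    have h' : p ∣ r := by exact_mod_cast h
    have hpr : p = r := (Nat.prime_dvd_prime_iff_eq hp hr'.1).mp h'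
    exact hpN (hpr ▸ hr'.2.1)
  rw [← hφ, jacobiSym.pow_left]
  rcases hf r hr with h1 | h2
  · rw [h1, if_pos rfl, pow_one]
  · rw [h2, if_neg (by norm_num), sq]
    exact ThreeFieldRoadSupply.jacobiSym_mul_self_eq_one hp hrp

/-- **`(p*/r) = (r/p)`** for distinct odd primes `p, r`, Jacobi-symbol currency (`legendreSym_pStar`).
[cite: IrelandRosen1990, Ch. 5 §2 Thm. 1] -/
theorem jacobiSym_pStar_eq_swap {p r : ℕ} (hp : p.Prime) (hr : r.Prime) (hp2 : p ≠ 2) (hr2 : r ≠ 2) :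
    J(((-1 : ℤ) ^ (p / 2) * p) | r) = J((r : ℤ) | p) := by
  haveI := Fact.mk hp
  haveI := Fact.mk hr
  rw [← jacobiSym.legendreSym.to_jacobiSym, ← jacobiSym.legendreSym.to_jacobiSym]
  exact WeierstrassCurve.legendreSym_pStar hp2 hr2

/-- **The reciprocity identity of design D2** (module docstring): for `p ∤ N` an odd prime, all exponents of `N` in `{1, 2}`,
`f_q ≠ 1`, `(D/r) = (p*/r)` at the odd `r ∥ N` other than `q`, and `(D/2) = (2/p) = 1` if `2 ∥ N`:
`∏_{r ∈ N.primeFactors ∖ {q}} [f_r = 1] (D/r) = (N/p)`. [cite: IrelandRosen1990, Ch. 5 §2] -/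
theorem prod_engine_eq_jacobiSym {N p q : ℕ} {D : ℤ} (hp : p.Prime) (hp2 : p ≠ 2) (hN0 : N ≠ 0) (hpN : ¬ p ∣ N)
    (hf : ∀ r ∈ N.primeFactors, N.factorization r = 1 ∨ N.factorization r = 2)
    (hq : N.factorization q ≠ 1)
    (hD : ∀ r ∈ N.primeFactors, r ≠ 2 → r ≠ q → N.factorization r = 1 →
      J(D | r) = J(((-1 : ℤ) ^ (p / 2) * p) | r))
    (hD2 : 2 ∈ N.primeFactors → N.factorization 2 = 1 → J(D | 2) = 1 ∧ J(2 | p) = 1) :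
    (∏ r ∈ N.primeFactors.erase q, (if N.factorization r = 1 then J(D | r) else 1)) = J((N : ℤ) | p) := by
  rw [jacobiSym_natCast_eq_prod_primeFactors hp hN0 hpN hf,
    ← Finset.prod_erase N.primeFactors (f := fun r ↦ if N.factorization r = 1 then J((r : ℤ) | p) else 1)
      (a := q) (by simp only [hq, if_false])]
  refine Finset.prod_congr rfl (fun r hr ↦ ?_)
  obtain ⟨hrq, hrN⟩ := Finset.mem_erase.mp hr
  by_cases h1 : N.factorization r = 1
  · simp only [h1, if_true]
    by_cases hr2 : r = 2
    · subst hr2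
      obtain ⟨hD2a, hD2b⟩ := hD2 hrN h1
      rw [hD2a, Nat.cast_ofNat, hD2b]
    · rw [hD r hrN hr2 hrq h1, jacobiSym_pStar_eq_swap hp (Nat.prime_of_mem_primeFactors hrN) hp2 hr2]
  · simp only [h1, if_false]

end Summit.BirchSwinnertonDyer.BirchSwinnertonDyer.Theorems.TwistedWanRoad
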